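import Mathlib
import Summits.Ventures.HodgeRepro2.Tier7.Line1.SepWeightFix

/-!
# Tier7/Line1/SepWeightComm — the commutant lemma for `Wmod s`

Continuation of `SepWeightFix` (t7-L1-p2, LINE L1 residual probe — the SEPARATING DATUM): THE COMMUTANT LEMMA
`CommutesOn.exists_scalar` — an operator commuting with every flip and sign on `Wmod s` (linear there and
preserving `Wmod s`) acts on `Wmod s` by a scalar. Proof: such an operator preserves every level (the «Fix»
characterisation), acts on each elementary function `chi s N A` by a scalar (joint eigenvector of the signs),
the scalar is flip-invariant hence constant on the level, and the levels are nested. Used for the centre of the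
Hecke group (field (H11a) `center_scalar` of the frozen datum).
Author: t7-L1-p2 (prover-pub-hodge-repro2-t7-L1-p2-g0-0). §8(d): NO.
-/

namespace Summit.Ventures.HodgeRepro2.Tier7.Line1.Sep

open Finset

noncomputable section

/-! ## The commutant lemma: an operator commuting with every flip and sign is a scalar on `Wmod s` -/

/-- a complex number equal to its negative is `0` -/
theorem eq_zero_of_neg_eq_self {x : ℂ} (h : -x = x) : x = 0 := by
  have h2 : x + x = 0 := eq_neg_iff_add_eq_zero.1 h.symm
  rw [← two_mul] at h2
  rcases mul_eq_zero.1 h2 with h3 | h3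
  · exact absurd h3 two_ne_zero
  · exact h3

/-- the scalar by which an operator `T` acts on `chi s N A` (evaluation at the base point of the cylinder) -/
def chiCoeff (s : ℕ → ℂ) (T : (Ω → ℂ) → (Ω → ℂ)) (N A : Finset ℕ) : ℂ := T (chi s N A) (A ∩ N)

/-- an operator commuting with all flips and signs on `Wmod s` (linear there, preserving `Wmod s`) -/
structure CommutesOn (s : ℕ → ℂ) (T : (Ω → ℂ) → (Ω → ℂ)) : Prop where
  map_add : ∀ f ∈ Wmod s, ∀ g ∈ Wmod s, T (f + g) = T f + T g
  map_smul : ∀ (c : ℂ), ∀ f ∈ Wmod s, T (c • f) = c • T f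
  mem : ∀ f ∈ Wmod s, T f ∈ Wmod s
  flip_comm : ∀ n, ∀ f ∈ Wmod s, T (flip n f) = flip n (T f)
  sgn_comm : ∀ n, ∀ f ∈ Wmod s, T (sgn n f) = sgn n (T f)

namespace CommutesOn

variable {s : ℕ → ℂ} {T : (Ω → ℂ) → (Ω → ℂ)} (hT : CommutesOn s T)
include hT

/-- `T` kills `0` -/
theorem map_zero : T 0 = 0 := by
  have := hT.map_smul 0 0 (Submodule.zero_mem _)
  rwa [zero_smul, zero_smul] at this

/-- `T` commutes with finite sums of elements of `Wmod s` -/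
theorem map_sum {ι : Type*} (S : Finset ι) (g : ι → (Ω → ℂ)) (hg : ∀ i ∈ S, g i ∈ Wmod s) :
    T (∑ i ∈ S, g i) = ∑ i ∈ S, T (g i) := by
  classical
  induction S using Finset.induction_on with
  | empty => simp [hT.map_zero]
  | insert a S haS ih =>
    rw [Finset.sum_insert haS, Finset.sum_insert haS,
      hT.map_add _ (hg a (mem_insert_self a S)) _
        (Submodule.sum_mem _ fun i hi => hg i (mem_insert_of_mem hi)),
      ih fun i hi => hg i (mem_insert_of_mem hi)]

/-- `T` commutes with `proj n` on `Wmod s` -/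
theorem proj_comm (n : ℕ) {f : Ω → ℂ} (hf : f ∈ Wmod s) : T (proj n f) = proj n (T f) := by
  have hsg : sgn n f ∈ Wmod s := (Wmod_stable s).sgn_mem n f hf
  rw [proj_eq n f, proj_eq n (T f), hT.map_smul _ _ (Submodule.add_mem _ hf hsg),
    hT.map_add f hf _ hsg, hT.sgn_comm n f hf]

/-- `T` commutes with `projc n` on `Wmod s` -/
theorem projc_comm (n : ℕ) {f : Ω → ℂ} (hf : f ∈ Wmod s) : T (projc n f) = projc n (T f) := by
  have hsg : sgn n f ∈ Wmod s := (Wmod_stable s).sgn_mem n f hf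
  rw [projc_eq n f, projc_eq n (T f), hT.map_smul _ _ (Submodule.sub_mem _ hf hsg),
    sub_eq_add_neg, hT.map_add f hf _ (Submodule.neg_mem _ hsg), ← neg_one_smul ℂ (sgn n f),
    hT.map_smul _ _ hsg, neg_one_smul, ← sub_eq_add_neg, hT.sgn_comm n f hf]

/-- `T` preserves every level -/
theorem mem_level {N : Finset ℕ} {f : Ω → ℂ} (hf : f ∈ level s N) : T f ∈ level s N := by
  have hfW : f ∈ Wmod s := level_le_Wmod s N hf
  refine mem_level_of_forall (hT.mem f hfW) fun n hn => ?_
  have h1 : projc n f ∈ Wmod s := (Wmod_stable s).projc_mem n hfW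
  rw [← hT.projc_comm n hfW, ← hT.flip_comm n _ h1, flip_projc_eq hf hn,
    hT.map_smul _ _ ((Wmod_stable s).proj_mem n hfW), hT.proj_comm n hfW]

/-- `T` acts on the elementary function `chi s N A` by the scalar `T (chi s N A) (A ∩ N)` -/
theorem T_chi (N A : Finset ℕ) : T (chi s N A) = T (chi s N A) (A ∩ N) • chi s N A := by
  have hWchi : chi s N A ∈ Wmod s := level_le_Wmod s N (chi_mem_level s N A)
  obtain ⟨G, hG⟩ := hT.mem_level (chi_mem_level s N A)
  -- vanishing off the cylinder of `A`
  have hvan : ∀ ω, ω ∩ N ≠ A ∩ N → T (chi s N A) ω = 0 := by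
    intro ω hω
    have hex : ∃ m ∈ N, ¬ (m ∈ ω ↔ m ∈ A) := by
      by_contra h
      push Not at h
      apply hω
      ext x
      simp only [mem_inter]
      constructor
      · rintro ⟨h1, h2⟩; exact ⟨(h x h2).1 h1, h2⟩
      · rintro ⟨h1, h2⟩; exact ⟨(h x h2).2 h1, h2⟩
    obtain ⟨m, hmN, hm⟩ := hex
    have h1 := congrFun (hT.sgn_comm m _ hWchi) ω
    rw [sgn_chi s hmN, hT.map_smul _ _ hWchi] at h1
    simp only [Pi.smul_apply, smul_eq_mul, sgn] at h1
    by_cases hmA : m ∈ A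
    · have hmω : m ∉ ω := fun h => hm ⟨fun _ => hmA, fun _ => h⟩
      simp only [hmA, hmω, if_true, if_false, neg_one_mul, one_mul] at h1
      exact eq_zero_of_neg_eq_self h1
    · have hmω : m ∈ ω := by
        by_contra h
        exact hm ⟨fun h' => absurd h' h, fun h' => absurd h' hmA⟩
      simp only [hmA, hmω, if_true, if_false, neg_one_mul, one_mul] at h1
      exact eq_zero_of_neg_eq_self h1.symm
  funext ω
  simp only [Pi.smul_apply, smul_eq_mul, chi]
  split_ifs with h
  · have e1 : A ∩ N ∩ N = A ∩ N := by rw [Finset.inter_assoc, Finset.inter_self]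
    have e2 : (A ∩ N) \ N = ∅ := Finset.sdiff_eq_empty_iff_subset.2 Finset.inter_subset_right
    rw [hG ω, hG (A ∩ N), h, e1, e2, wt_empty, mul_one]
  · rw [hvan ω h, mul_zero]

/-- the scalar of `chi` is invariant under the flips of the qubits of `N` -/
theorem coeff_flip {N : Finset ℕ} {m : ℕ} (hm : m ∈ N) (A : Finset ℕ) :
    chiCoeff s T N (symmDiff A {m}) = chiCoeff s T N A := by
  have h := hT.flip_comm m _ (level_le_Wmod s N (chi_mem_level s N A))
  rw [flip_chi s hm, hT.T_chi N A, flip_smul, flip_chi s hm] at h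
  have := congrFun h ((symmDiff A {m}) ∩ N)
  rw [Pi.smul_apply, smul_eq_mul, chi_apply_self, mul_one] at this
  exact this

omit hT in
/-- the scalar of `chi s N A` depends on `A` only through `A ∩ N` -/
theorem coeff_inter (N A : Finset ℕ) : chiCoeff s T N A = chiCoeff s T N (A ∩ N) := by
  have e1 : A ∩ N ∩ N = A ∩ N := by rw [Finset.inter_assoc, Finset.inter_self]
  unfold chiCoeff
  rw [chi_congr s e1.symm, e1]

/-- the scalar of every `chi` of level `N` is that of `chi s N ∅` -/
theorem coeff_eq_empty (N A : Finset ℕ) : chiCoeff s T N A = chiCoeff s T N ∅ := by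
  rw [coeff_inter N A]
  have key : ∀ B : Finset ℕ, B ⊆ N → chiCoeff s T N B = chiCoeff s T N ∅ := by
    intro B
    induction B using Finset.induction_on with
    | empty => intro _; rfl
    | insert m B hmB ih =>
      intro hB
      have hm : m ∈ N := hB (mem_insert_self m B)
      have hins : insert m B = symmDiff B {m} := by
        rw [Finset.insert_eq, Disjoint.symmDiff_eq_sup (by simpa using hmB), sup_comm]
        rfl
      rw [hins, hT.coeff_flip hm, ih fun x hx => hB (mem_insert_of_mem hx)]
  exact key _ Finset.inter_subset_right

/-- `T` is the scalar `chiCoeff s T N ∅` on the whole level `N` -/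
theorem eq_smul_of_mem_level {N : Finset ℕ} {f : Ω → ℂ} (hf : f ∈ level s N) :
    T f = chiCoeff s T N ∅ • f := by
  obtain ⟨F, hF⟩ := hf
  rw [eq_sum_chi hF, hT.map_sum _ _ fun A _ =>
    Submodule.smul_mem _ _ (level_le_Wmod s N (chi_mem_level s N A)), Finset.smul_sum]
  refine Finset.sum_congr rfl fun A _ => ?_
  rw [hT.map_smul _ _ (level_le_Wmod s N (chi_mem_level s N A)), hT.T_chi N A]
  have : T (chi s N A) (A ∩ N) = chiCoeff s T N ∅ := hT.coeff_eq_empty N A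
  rw [this, smul_smul, smul_smul, mul_comm]

/-- THE COMMUTANT LEMMA: `T` is a scalar on `Wmod s` -/
theorem exists_scalar : ∃ c : ℂ, ∀ f ∈ Wmod s, T f = c • f := by
  refine ⟨chiCoeff s T ∅ ∅, fun f hf => ?_⟩
  obtain ⟨N, hN⟩ := mem_Wmod_iff.1 hf
  rw [hT.eq_smul_of_mem_level hN]
  congr 1
  have h1 := hT.eq_smul_of_mem_level (level_mono (Finset.empty_subset N) (chi_mem_level s ∅ ∅))
  have h2 := hT.eq_smul_of_mem_level (chi_mem_level s ∅ ∅)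
  rw [h1] at h2
  exact smul_left_injective ℂ (chi_ne_zero s ∅ ∅) h2

end CommutesOn

end

end Summit.Ventures.HodgeRepro2.Tier7.Line1.Sep
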